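import Literature.RingTheory.CompleteIntersection.NumericalCriterion
import Literature.NumberTheory.GaloisRepresentations.PotentialDiagonalizabilityCriteriaProofs

/-!
# `ResiduallyYoshidaLifting` (stmt-Langlands-13639) — Negative knowledge on STUB 2
# (`stub_numericalCriterionDVR` of line `yoshida-divisor-selmer-count`): hypothesis hygiene

From the deep-refute seat of the picked line (drefute, 2026-08-16), complementing the standing
disprover's `Cruxes/ResiduallyYoshidaLifting/Disproof.lean` (T2/T5).  STUB 2 is the Wiles–Lenstra
numerical criterion over a complete DVR with ARBITRARY residue field; it is TRUE in print
(de Smit–Rubin–Schoof 1997, Criterion I, p. 344 of *Modular Forms and Fermat's Last Theorem*: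
"`O` a complete Noetherian local ring with residue field `k`" — no finiteness — "Suppose that `O` is a
complete discrete valuation ring and that `η_T ≠ 0` …"; proof pp. 352–354, field case + Nakayama)
and it is NOT refuted here.  This file lands what the lead and later seats can cite:

* `NumericalCriterionDVR` — VERBATIM copy of the registered stub statement (the Cruxes work-files
  are not importable modules), and `numericalCriterionDVR_of_numericalCriterion_eq_iff`: the stub is
  EXACTLY the forward ("`φ` bijective") half of the tree's named fact
  `Literature.RingTheory.CompleteIntersection.numericalCriterion_eq_iff.{0,0,0}` given the PROVED
  inequality `numericalCriterion_le_holds` — its `η` and `Φ` are definitionally the tree's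
  `congruenceIdeal π` and `CotangentModule (π.comp φ)` (`eta_eq_congruenceIdeal`,
  `cotangent_eq_cotangentModule`, both `rfl`).  One debt (`numericalCriterion_eq_iff`, which also
  grounds route item stmt-Langlands-2178), one proof, several consumers.
* `NumericalCriterionDVRWithoutEta` + `numericalCriterionDVR_false_without_eta` — the hypothesis
  `η ≠ ⊥` (`eta_ne_bot` of the line's `LocalCriterionDatum`) is LOAD-BEARING: with it dropped the
  statement is false.  Kernel-checked small model: `O = ℤ₂`, `A = ℤ₂⟦X⟧`, `B = ℤ₂⟦X⟧ ⧸ (X²)`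
  (local, free of rank 2 with basis `1, X̄`), `φ` the quotient map (surjective, not injective),
  `π` the constant coefficient; `ker π = (X̄) = Ann_B(ker π)`, so `η = π(Ann_B ker π) = 0`,
  `length_O(O ⧸ η) = ⊤` and the numerical inequality holds for free.  (The standing disprover's
  T2 records this witness on paper; `IsAdicComplete (𝔪, X) ℤ₂⟦X⟧` is the tree's
  `powerSeries_isAdicComplete_maximalIdeal`.)

Paper-level mutation table for the remaining hypotheses of STUB 2 (not formalised; recorded for the
prover): `Module.Free O B` is load-bearing (witness `A = O⟦X⟧/(X² − ϖX) ↠ B = O⟦X⟧/(X², ϖX)`,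
`π = ` constant term: `Φ_A ≅ O/ϖ`, `η_B = (ϖ)`, `Ψ_B = 1`, `φ` kills `ϖX̄ ≠ 0`);
`Function.Surjective φ` is load-bearing (witness `A = O ↪ B = O ×_k O` diagonally, `π = pr₁`:
`Φ_A = 0 ≤ Ψ_B = 1`); whereas `IsAdicComplete 𝔪_A A` is REDUNDANT (apply the criterion to the
completion `Â ↠ B`: `Φ_Â = Φ_A` since `I_A/I_A²` is a finite `O`-module, then `A ↪ Â ≅ B` by Krull),
`IsNoetherianRing A` is redundant given completeness and `length Φ_A < ⊤` (Cohen: `A` is then a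
quotient of `O⟦X₁,…,Xₙ⟧`), `IsLocalRing B` is redundant (`B` is a non-trivial quotient of the local
`A`), and `IsAdicComplete 𝔪_O O` is redundant (`O = A/I_A` is a quotient of the complete `A`).
Mathlib + two Literature modules only. [folklore]
-/

noncomputable section

set_option linter.dupNamespace false

namespace Summit.Langlands.Langlands.Theorems.ResiduallyYoshidaLifting.Negative

open Literature.RingTheory.CompleteIntersection PowerSeries IsLocalRing

/-! ### The registered stub and its reduction to the Literature named fact -/

/-- VERBATIM copy of the statement of STUB 2 `stub_numericalCriterionDVR` of
`Cruxes/ResiduallyYoshidaLifting/Lines/yoshida-divisor-selmer-count.lean` (= the named `Prop`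
`NumericalCriterionDVR` there; registered 2026-08-16T00:58:56Z, skeleton sha edead940…): the
Wiles–Lenstra numerical criterion over a complete DVR with arbitrary residue field.
[cite: DeSmitRubinSchoof1997, Criterion I, p. 344] -/
def NumericalCriterionDVR : Prop :=
  ∀ (O : Type) [CommRing O] [IsDomain O] [IsDiscreteValuationRing O]
    [IsAdicComplete (IsLocalRing.maximalIdeal O) O]
    (A : Type) [CommRing A] [IsLocalRing A] [IsNoetherianRing A] [Algebra O A]
    [IsAdicComplete (IsLocalRing.maximalIdeal A) A]
    (B : Type) [CommRing B] [IsLocalRing B] [Algebra O B] [Module.Finite O B] [Module.Free O B]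
    (φ : A →ₐ[O] B) (π : B →ₐ[O] O),
    Function.Surjective φ →
    Ideal.map (π : B →+* O) (RingHom.ker (π : B →+* O)).annihilator ≠ ⊥ →
    Module.length O (RingHom.ker ((π : B →+* O).comp (φ : A →+* B))).Cotangent ≤
      Module.length O (O ⧸ Ideal.map (π : B →+* O) (RingHom.ker (π : B →+* O)).annihilator) →
    Function.Bijective φ

/-- The stub's congruence ideal `π(Ann_B(ker π))` IS the tree's `congruenceIdeal π`
(definitionally). [folklore] -/
theorem eta_eq_congruenceIdeal (O B : Type) [CommRing O] [CommRing B] [Algebra O B]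
    (π : B →ₐ[O] O) :
    Ideal.map (π : B →+* O) (RingHom.ker (π : B →+* O)).annihilator = congruenceIdeal π := rfl

/-- The stub's cotangent module `ker(π ∘ φ)/ker(π ∘ φ)²` IS the tree's
`CotangentModule (π.comp φ)` (definitionally, as types). [folklore] -/
theorem cotangent_eq_cotangentModule (O A B : Type) [CommRing O] [CommRing A] [CommRing B]
    [Algebra O A] [Algebra O B] (φ : A →ₐ[O] B) (π : B →ₐ[O] O) :
    (RingHom.ker ((π : B →+* O).comp (φ : A →+* B))).Cotangent = CotangentModule (π.comp φ) := rfl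

/-- **STUB 2 = the forward half of dSRS Criterion I.** The registered stub follows from the tree's
named fact `numericalCriterion_eq_iff` (de Smit–Rubin–Schoof 1997, Criterion I, equality case —
unproved in the tree) and the PROVED inequality `numericalCriterion_le_holds`, by
`bijective_of_numericalCriterion`. [cite: DeSmitRubinSchoof1997, Criterion I, p. 344] -/
theorem numericalCriterionDVR_of_numericalCriterion_eq_iff
    (h₂ : numericalCriterion_eq_iff.{0, 0, 0}) : NumericalCriterionDVR := by
  intro O _ _ _ _ A _ _ _ _ _ B _ _ _ _ _ φ π hφ hη hle
  exact bijective_of_numericalCriterion numericalCriterion_le_holds h₂ φ π hφ hη hle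

/-! ### `η ≠ ⊥` is load-bearing: a small model -/

/-- STUB 2 with the hypothesis `Ideal.map π (ker π).annihilator ≠ ⊥` DROPPED (verbatim otherwise).
FALSE: `numericalCriterionDVR_false_without_eta`. [folklore] -/
def NumericalCriterionDVRWithoutEta : Prop :=
  ∀ (O : Type) [CommRing O] [IsDomain O] [IsDiscreteValuationRing O]
    [IsAdicComplete (IsLocalRing.maximalIdeal O) O]
    (A : Type) [CommRing A] [IsLocalRing A] [IsNoetherianRing A] [Algebra O A]
    [IsAdicComplete (IsLocalRing.maximalIdeal A) A]
    (B : Type) [CommRing B] [IsLocalRing B] [Algebra O B] [Module.Finite O B] [Module.Free O B]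
    (φ : A →ₐ[O] B) (π : B →ₐ[O] O),
    Function.Surjective φ →
    Module.length O (RingHom.ker ((π : B →+* O).comp (φ : A →+* B))).Cotangent ≤
      Module.length O (O ⧸ Ideal.map (π : B →+* O) (RingHom.ker (π : B →+* O)).annihilator) →
    Function.Bijective φ

/-- The original stub trivially implies nothing about the dropped version; conversely the dropped
version implies the stub (it has fewer hypotheses). [folklore] -/
theorem numericalCriterionDVR_of_withoutEta (h : NumericalCriterionDVRWithoutEta) :
    NumericalCriterionDVR :=
  fun O _ _ _ _ A _ _ _ _ _ B _ _ _ _ _ φ π hφ _ hle => h O A B φ π hφ hle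

namespace EtaWitness

/-- The ideal `(X²)` of `ℤ₂⟦X⟧`. [folklore] -/
abbrev J : Ideal (ℤ_[2]⟦X⟧) := Ideal.span {(X : ℤ_[2]⟦X⟧) ^ 2}

/-- The Hecke side of the witness: `B = ℤ₂⟦X⟧ ⧸ (X²)` (dual numbers over `ℤ₂`). [folklore] -/
abbrev B : Type := ℤ_[2]⟦X⟧ ⧸ J

/-- `(X²)` is a proper ideal. [folklore] -/
theorem J_ne_top : J ≠ ⊤ := by
  intro h
  have h1 : (1 : ℤ_[2]⟦X⟧) ∈ J := h ▸ Submodule.mem_top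
  rw [Ideal.mem_span_singleton] at h1
  have h2 := (PowerSeries.X_pow_dvd_iff).1 h1 0 (by norm_num)
  simp at h2

/-- `B` is non-trivial. [folklore] -/
instance : Nontrivial B := Ideal.Quotient.nontrivial_iff.mpr J_ne_top

/-- `B` is local (a non-trivial quotient of the local ring `ℤ₂⟦X⟧`). [folklore] -/
instance : IsLocalRing B :=
  IsLocalRing.of_surjective' (Ideal.Quotient.mk J) Ideal.Quotient.mk_surjective

/-- The two low coefficients of a power series, `ℤ₂`-linearly. [folklore] -/
def coeffs : ℤ_[2]⟦X⟧ →ₗ[ℤ_[2]] (Fin 2 → ℤ_[2]) :=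
  LinearMap.pi fun i => PowerSeries.coeff (i : ℕ)

/-- Unfolding of `coeffs`. [folklore] -/
theorem coeffs_apply (f : ℤ_[2]⟦X⟧) (i : Fin 2) : coeffs f i = PowerSeries.coeff (i : ℕ) f := rfl

/-- `(X²)` is killed by the two low coefficients. [folklore] -/
theorem J_le_ker_coeffs : J.restrictScalars ℤ_[2] ≤ LinearMap.ker coeffs := by
  intro f hf
  change f ∈ J at hf
  rw [Ideal.mem_span_singleton] at hf
  rw [LinearMap.mem_ker]
  funext i
  rw [coeffs_apply]
  exact (PowerSeries.X_pow_dvd_iff).1 hf i (by have := i.isLt; omega)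

/-- `B → ℤ₂²`, the two low coefficients. [folklore] -/
def coeffsQ : B →ₗ[ℤ_[2]] (Fin 2 → ℤ_[2]) :=
  ((J.restrictScalars ℤ_[2]).liftQ coeffs J_le_ker_coeffs).comp
    (Submodule.Quotient.restrictScalarsEquiv ℤ_[2] J).symm.toLinearMap

/-- `coeffsQ` on a class. [folklore] -/
theorem coeffsQ_mk (f : ℤ_[2]⟦X⟧) : coeffsQ (Ideal.Quotient.mk J f) = coeffs f := rfl

/-- `coeffsQ : B → ℤ₂²` is bijective (`f ≡ f₀ + f₁X mod X²`). [folklore] -/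
theorem coeffsQ_bijective : Function.Bijective coeffsQ := by
  constructor
  · rw [← LinearMap.ker_eq_bot, Submodule.eq_bot_iff]
    intro q hq
    induction q using Quotient.inductionOn' with
    | h f =>
      change coeffsQ (Ideal.Quotient.mk J f) = 0 at hq
      change Ideal.Quotient.mk J f = 0
      rw [coeffsQ_mk] at hq
      rw [Ideal.Quotient.eq_zero_iff_mem, Ideal.mem_span_singleton, PowerSeries.X_pow_dvd_iff]
      intro m hm
      have := congrFun hq ⟨m, hm⟩
      rwa [coeffs_apply] at this
  · intro a
    refine ⟨Ideal.Quotient.mk J (C (a 0) + C (a 1) * X), ?_⟩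
    rw [coeffsQ_mk]
    funext i
    rw [coeffs_apply]
    fin_cases i <;> simp [PowerSeries.coeff_C]

/-- `B ≃ ℤ₂²` as `ℤ₂`-modules. [folklore] -/
def coeffsEquiv : B ≃ₗ[ℤ_[2]] (Fin 2 → ℤ_[2]) := LinearEquiv.ofBijective coeffsQ coeffsQ_bijective

/-- `B` is free over `ℤ₂`. [folklore] -/
instance : Module.Free ℤ_[2] B := Module.Free.of_equiv coeffsEquiv.symm

/-- `B` is finite over `ℤ₂`. [folklore] -/
instance : Module.Finite ℤ_[2] B := Module.Finite.equiv coeffsEquiv.symm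

/-- The constant coefficient `ℤ₂⟦X⟧ → ℤ₂` as a `ℤ₂`-algebra map. [folklore] -/
def cc : ℤ_[2]⟦X⟧ →ₐ[ℤ_[2]] ℤ_[2] :=
  { PowerSeries.constantCoeff (R := ℤ_[2]) with
    commutes' := fun r => by simp }

/-- Unfolding of `cc`. [folklore] -/
theorem cc_apply (f : ℤ_[2]⟦X⟧) : cc f = PowerSeries.constantCoeff f := rfl

/-- `(X²)` is killed by the constant coefficient. [folklore] -/
theorem J_le_ker_cc : ∀ a ∈ J, cc a = 0 := by
  intro a ha
  rw [Ideal.mem_span_singleton] at ha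
  rw [cc_apply, ← PowerSeries.coeff_zero_eq_constantCoeff_apply]
  exact (PowerSeries.X_pow_dvd_iff).1 ha 0 (by norm_num)

/-- The augmentation `π : B → ℤ₂` (constant coefficient). [folklore] -/
def π : B →ₐ[ℤ_[2]] ℤ_[2] := Ideal.Quotient.liftₐ J cc J_le_ker_cc

/-- `π` on a class. [folklore] -/
theorem π_mk (f : ℤ_[2]⟦X⟧) : π (Ideal.Quotient.mk J f) = PowerSeries.constantCoeff f := rfl

/-- The deformation side map `φ : ℤ₂⟦X⟧ ↠ B` (the quotient map). [folklore] -/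
def φ : ℤ_[2]⟦X⟧ →ₐ[ℤ_[2]] B := Ideal.Quotient.mkₐ ℤ_[2] J

/-- The congruence ideal of the witness vanishes: `η = π(Ann_B(ker π)) = 0`
(`Ann_B(X̄) = (X̄) ⊆ ker π`). [folklore] -/
theorem eta_eq_bot :
    Ideal.map (π : B →+* ℤ_[2]) (RingHom.ker (π : B →+* ℤ_[2])).annihilator = ⊥ := by
  rw [← le_bot_iff, Ideal.map_le_iff_le_comap]
  intro b hb
  rw [Ideal.mem_comap, Ideal.mem_bot]
  rw [Submodule.mem_annihilator] at hb
  have hX : (Ideal.Quotient.mk J X : B) ∈ RingHom.ker (π : B →+* ℤ_[2]) := by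
    rw [RingHom.mem_ker]
    change π (Ideal.Quotient.mk J X) = 0
    rw [π_mk, PowerSeries.constantCoeff_X]
  have hbX := hb _ hX
  obtain ⟨f, rfl⟩ := Ideal.Quotient.mk_surjective b
  rw [smul_eq_mul, ← map_mul, Ideal.Quotient.eq_zero_iff_mem, Ideal.mem_span_singleton] at hbX
  have hXf : (X : ℤ_[2]⟦X⟧) ∣ f := by
    have h2 : (X : ℤ_[2]⟦X⟧) * X ∣ f * X := by simpa [pow_two] using hbX
    exact (mul_dvd_mul_iff_right PowerSeries.X_ne_zero).1 h2
  change π (Ideal.Quotient.mk J f) = 0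
  rw [π_mk]
  exact (PowerSeries.X_dvd_iff).1 hXf

/-- `φ` is not injective (`X² ↦ 0`). [folklore] -/
theorem φ_not_injective : ¬ Function.Injective φ := by
  intro h
  have h0 : φ ((X : ℤ_[2]⟦X⟧) ^ 2) = φ 0 := by
    rw [map_zero]
    exact Ideal.Quotient.eq_zero_iff_mem.2 (Ideal.subset_span rfl)
  exact pow_ne_zero 2 PowerSeries.X_ne_zero (h h0)

end EtaWitness

open EtaWitness in
/-- **`η ≠ ⊥` is load-bearing in STUB 2** (`stub_numericalCriterionDVR`): with the hypothesis
`Ideal.map π (ker π).annihilator ≠ ⊥` dropped the numerical criterion is FALSE — witness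
`ℤ₂⟦X⟧ ↠ ℤ₂⟦X⟧ ⧸ (X²) → ℤ₂` (`η = 0`, right-hand side `= length ℤ₂ = ⊤`, `φ` not injective).
Any proof of the stub must use `eta_ne_bot`. [folklore] -/
theorem numericalCriterionDVR_false_without_eta : ¬ NumericalCriterionDVRWithoutEta := by
  intro h
  haveI : IsAdicComplete (maximalIdeal ℤ_[2]⟦X⟧) ℤ_[2]⟦X⟧ :=
    Literature.NumberTheory.GaloisRepresentations.powerSeries_isAdicComplete_maximalIdeal
  have hsurj : Function.Surjective φ := Ideal.Quotient.mkₐ_surjective ℤ_[2] J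
  have htop : Module.length ℤ_[2]
      (ℤ_[2] ⧸ Ideal.map (π : B →+* ℤ_[2]) (RingHom.ker (π : B →+* ℤ_[2])).annihilator) = ⊤ := by
    by_contra hne
    exact congruenceIdeal_ne_bot_of_length_ne_top π hne eta_eq_bot
  have hle : Module.length ℤ_[2]
      (RingHom.ker ((π : B →+* ℤ_[2]).comp (φ : ℤ_[2]⟦X⟧ →+* B))).Cotangent ≤
      Module.length ℤ_[2]
        (ℤ_[2] ⧸ Ideal.map (π : B →+* ℤ_[2]) (RingHom.ker (π : B →+* ℤ_[2])).annihilator) := by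
    rw [htop]; exact le_top
  exact φ_not_injective (h ℤ_[2] (ℤ_[2]⟦X⟧) B φ π hsurj hle).1

end Summit.Langlands.Langlands.Theorems.ResiduallyYoshidaLifting.Negative

end
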